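import Summits.CriticalPhenomena.SAWScalingLimit.Theorems.SAWDevelopingMapInteriorFlatteningReentryFixedRadius

/-!
# `InteriorFlattening` (stmt-CriticalPhenomena-8297), line `one-mouth-ball-reduction`:
# S5' — windowed re-entry arm separation — as a CONDITIONAL reduction to the named estimates E1 + E2 + E3

Crux (M) = `Summit.CriticalPhenomena.SAWScalingLimit.Theses.SAWDevelopingMap.InteriorFlattening`; stub S5'
`stub_reentryArmSeparation` (windowed at reshape r2: `B(v,2r) ⊆ Λ`, `¬ B(v,4r) ⊆ Λ`) of the skeleton
`Cruxes/InteriorFlattening/Lines/one_mouth_ball_reduction.lean`. The stub is research-level open (no multi-arm /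
separation technology for planar SAW at `n = 0`) and is NOT proved here. This file kernel-checks that the
FULL registered two-conjunct statement

  (i)  `∀ ϑ > 0 ∃ η ∈ (0,1] ∃ r₀ ∀ r ≥ r₀ …`: configurations of `S = B(v,r)` unclean at `ηr` carry at most
       `ϑ` of the coherent weight `Σ_c ‖amp_c‖ ‖M_c‖`;
  (ii) fixed-radius re-entries carry, even in inner-mass weight, at most `ϑ Σ_c ‖amp_c‖ ‖M_c‖` for `r ≥ r₀`,

FOLLOWS from the three named (open, NOT asserted) estimates of
`…Theorems.SAWDevelopingMapInteriorFlatteningOneMouthEstimates`, entering ONLY AS HYPOTHESES: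
`CoherentReentryGap ρ` (E1), `CleanMonopoleLowerBound κ` (E2), `MonopoleDecoherence κ` (E3), `0 ≤ κ < ρ`
(heuristically `κ = 25/48`, `ρ = 3/2`).

* `reentryAspect_of_armEstimates` — (i) ⇐ E1 + E2 + E3 by dyadic tiers: tier `t ∈ [2^j s, 2^{j+1} s)` of the
  inner clean radius costs `C₁ t^{-κ}` (E3) times `C (2t/r)^ρ` (E1) times `2 c₀⁻¹ r^κ` (E1 at `θr` + E2), a
  geometric series in `2^{ρ-κ} > 1` dominated by its top tier `t ≈ ηr`, i.e. `O(η^{ρ-κ})`; the bottom tier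
  (`t < 2`) is `O(r^{κ-ρ})`;
* `reentryArmSeparation_of_armEstimates` — (i) ∧ (ii), conjunct (ii) being
  `reentryFixedRadius_of_armEstimates` of `…Theorems.SAWDevelopingMapInteriorFlatteningReentryFixedRadius`.
  Its conclusion is the registered signature of `stub_reentryArmSeparation`, verbatim.
-/

noncomputable section

open scoped BigOperators
open Literature.Probability.LatticeModels Literature.Probability.RandomPlanarGeometry.SAW

namespace Summit.CriticalPhenomena.SAWScalingLimit.Theorems.InteriorFlattening.OneMouth

/-! ### Glue -/

/-- `‖M_D(v)‖ ≤ pmass_D(v)` (triangle inequality and `‖F‖ ≤ mass` at each of the three ports). -/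
theorem norm_mono_le_pmass (D : Finset HexVertex) (q : Sym2 HexVertex) (v w₀ w₁ w₂ : HexVertex) :
    ‖mono D q v w₀ w₁ w₂‖ ≤ pmass D q v w₀ w₁ w₂ := by
  unfold mono pmass
  have h0 := norm_Fobs_le_zmass D q s(v, w₀)
  have h1 := norm_Fobs_le_zmass D q s(v, w₁)
  have h2 := norm_Fobs_le_zmass D q s(v, w₂)
  exact (norm_add₃_le).trans (by linarith)

/-! ### S5'(i) from E1 + E2 + E3 -/

/-- **S5'(i) ⇐ E1 + E2 + E3 (conditional reduction; the estimates are hypotheses, not asserted).**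
Dyadic tiers: configurations unclean at `η r` carry at most `K η^{ρ-κ} + K₂ r^{κ-ρ}` of the coherent
weight, where tier `t ∈ [2^j s, 2^{j+1} s)` of the inner clean radius costs `C₁ t^{-κ}` (E3) times
`C (2t/r)^ρ` (E1) times `2 c₀⁻¹ r^κ` (E2 on the half of the weight clean at `θ r`). -/
theorem reentryAspect_of_armEstimates {ρ κ : ℝ} (hκ : 0 ≤ κ) (hκρ : κ < ρ)
    (h1 : CoherentReentryGap ρ) (h2 : CleanMonopoleLowerBound κ) (h3 : MonopoleDecoherence κ) :
    ∀ ϑ : ℝ, 0 < ϑ → ∃ η : ℝ, 0 < η ∧ η ≤ 1 ∧ ∃ r₀ : ℝ, ∀ r : ℝ, r₀ ≤ r →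
      ∀ Λ : Finset HexVertex, hexDomainSimplyConnected Λ → ∀ a ∈ hexDomainBoundary Λ, ∀ v ∈ Λ,
        Deep Λ v (2 * r) → ¬ Deep Λ v (4 * r) → ∀ w₀ w₁ w₂ : HexVertex, IsStar v w₀ w₁ w₂ →
          (∑ c ∈ (Conf Λ (ball Λ v r)).filter (fun c => ¬ Clean (ball Λ v r) c.1 v (η * r)),
              ‖amp Λ a (ball Λ v r) c‖ * ‖mono c.1 (root c) v w₀ w₁ w₂‖) ≤
            ϑ * ∑ c ∈ Conf Λ (ball Λ v r),
              ‖amp Λ a (ball Λ v r) c‖ * ‖mono c.1 (root c) v w₀ w₁ w₂‖ := by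
  intro ϑ hϑ
  obtain ⟨C, hC, r₁, hE1⟩ := h1
  obtain ⟨C₁, hC₁, hE3⟩ := h3
  have hρ : 0 < ρ := lt_of_le_of_lt hκ hκρ
  -- an aspect ratio `θ` with `C θ^ρ ≤ 1/2`
  set b : ℝ := 1 / (2 * (C + 1)) with hb
  have hb0 : 0 < b := by positivity
  have hb1 : b < 1 := by
    rw [hb, div_lt_one (by positivity)]; linarith
  set θ : ℝ := b ^ (1 / ρ) with hθ
  have hθ0 : 0 < θ := Real.rpow_pos_of_pos hb0 _
  have hθ1 : θ < 1 := Real.rpow_lt_one hb0.le hb1 (by positivity)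
  have hθρ : θ ^ ρ = b := by rw [hθ, one_div, Real.rpow_inv_rpow hb0.le hρ.ne']
  have hCθ : C * θ ^ ρ ≤ 1 / 2 := by
    rw [hθρ, hb, mul_one_div, div_le_div_iff₀ (by positivity) (by norm_num)]
    linarith
  obtain ⟨c₀, hc₀, r₂, hE2⟩ := h2 θ hθ0 hθ1.le
  -- tier ratio and constants
  set δ : ℝ := ρ - κ with hδ
  have hδ0 : 0 < δ := by rw [hδ]; linarith
  set q : ℝ := (2 : ℝ) ^ δ with hq
  have hq1 : 1 < q := Real.one_lt_rpow one_lt_two hδ0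
  have hq1' : 0 < q - 1 := by linarith
  set A : ℝ := 2 ^ κ * (2 * C * C₁ / c₀) with hA
  have hA0 : 0 ≤ A := by positivity
  have hAq0 : 0 ≤ A * (q / (q - 1)) := by positivity
  set B : ℝ := A * (q / (q - 1)) + 1 with hB
  have hB0 : 0 < B := by positivity
  -- the aspect ratio `η` with `A q/(q-1) η^δ ≤ ϑ/2`
  set b' : ℝ := ϑ / (2 * B) with hb'
  have hb'0 : 0 < b' := by positivity
  set η₀ : ℝ := b' ^ (1 / δ) with hη₀
  have hη₀0 : 0 < η₀ := Real.rpow_pos_of_pos hb'0 _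
  set η : ℝ := min 1 η₀ with hη
  have hη0 : 0 < η := lt_min one_pos hη₀0
  have hη1 : η ≤ 1 := min_le_left _ _
  have hηδ : η ^ δ ≤ b' := by
    calc η ^ δ ≤ η₀ ^ δ := Real.rpow_le_rpow hη0.le (min_le_right _ _) hδ0.le
      _ = b' := by rw [hη₀, one_div, Real.rpow_inv_rpow hb'0.le hδ0.ne']
  have hmain : A * (q / (q - 1)) * η ^ δ ≤ ϑ / 2 := by
    have h1' : A * (q / (q - 1)) ≤ B := by rw [hB]; linarith
    calc A * (q / (q - 1)) * η ^ δ ≤ B * b' :=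
          mul_le_mul h1' hηδ (Real.rpow_nonneg hη0.le _) hB0.le
      _ = ϑ / 2 := by rw [hb']; field_simp
  -- the bottom tier constant and the choice of `r₀`
  set K₂ : ℝ := 2 * C * 2 ^ ρ / c₀ with hK₂
  have hlim : Filter.Tendsto (fun r : ℝ => K₂ * r ^ (κ - ρ)) Filter.atTop (nhds 0) := by
    have h := (tendsto_rpow_neg_atTop (y := ρ - κ) (by linarith)).const_mul K₂
    rw [mul_zero] at h
    refine h.congr' (Filter.Eventually.of_forall fun r => ?_)
    simp only [neg_sub]
  obtain ⟨R, hR⟩ := Filter.eventually_atTop.1 ((tendsto_order.1 hlim).2 (ϑ / 2) (by positivity))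
  refine ⟨η, hη0, hη1, max (max r₁ r₂) (max (max (2 / θ) (1 / η)) R), ?_⟩
  intro r hr Λ hΛ a ha v hv hdeep hwin w₀ w₁ w₂ hstar
  have hr₁ : r₁ ≤ r := le_trans (le_trans (le_max_left _ _) (le_max_left _ _)) hr
  have hr₂ : r₂ ≤ r := le_trans (le_trans (le_max_right _ _) (le_max_left _ _)) hr
  have hrθ : 2 / θ ≤ r :=
    le_trans (le_trans (le_trans (le_max_left _ _) (le_max_left _ _)) (le_max_right _ _)) hr
  have hrη : 1 / η ≤ r :=
    le_trans (le_trans (le_trans (le_max_right _ _) (le_max_left _ _)) (le_max_right _ _)) hr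
  have hrR : R ≤ r := le_trans (le_trans (le_max_right _ _) (le_max_right _ _)) hr
  have hθr2 : 2 ≤ θ * r := by rw [div_le_iff₀ hθ0] at hrθ; linarith
  have hr0 : 0 < r := by
    have : 0 < θ * r := lt_of_lt_of_le two_pos hθr2
    exact pos_of_mul_pos_right this hθ0.le
  have hθrr : θ * r ≤ r := mul_le_of_le_one_left hr0.le hθ1.le
  have hr2 : 2 ≤ r := hθr2.trans hθrr
  have hηr1 : 1 ≤ η * r := by rw [div_le_iff₀ hη0] at hrη; linarith
  have hηrr : η * r ≤ r := mul_le_of_le_one_left hr0.le hη1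
  set S : Finset HexVertex := ball Λ v r with hS
  set f : Config → ℝ := fun c => ‖amp Λ a S c‖ * pmass c.1 (root c) v w₀ w₁ w₂ with hf
  set g : Config → ℝ := fun c => ‖amp Λ a S c‖ * ‖mono c.1 (root c) v w₀ w₁ w₂‖ with hg
  have hf0 : ∀ c, 0 ≤ f c := fun c => mul_nonneg (norm_nonneg _) (pmass_nonneg _ _ _ _ _ _)
  have hg0 : ∀ c, 0 ≤ g c := fun c => mul_nonneg (norm_nonneg _) (norm_nonneg _)
  have hgf : ∀ c, g c ≤ f c := fun c =>
    mul_le_mul_of_nonneg_left (norm_mono_le_pmass _ _ _ _ _ _) (norm_nonneg _)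
  set N : ℝ := ∑ c ∈ Conf Λ S, g c with hNdef
  have hNnn : 0 ≤ N := Finset.sum_nonneg fun c _ => hg0 c
  -- (1) the total `f`-weight is at most `2 c₀⁻¹ r^κ N` (E1 at `θ r`, E2)
  have hP₂ : (∑ c ∈ (Conf Λ S).filter (fun c => ¬ Clean S c.1 v (θ * r)), f c) ≤
      C * (θ * r / r) ^ ρ * ∑ c ∈ Conf Λ S, f c :=
    hE1 r hr₁ (θ * r) (by linarith) hθrr Λ hΛ a ha v hv hdeep hwin w₀ w₁ w₂ hstar
  have hθrr' : θ * r / r = θ := by field_simp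
  rw [hθrr'] at hP₂
  have hsplit :=
    Finset.sum_filter_add_sum_filter_not (Conf Λ S) (fun c => Clean S c.1 v (θ * r)) f
  have hPall : (∑ c ∈ Conf Λ S, f c) ≤
      2 * ∑ c ∈ (Conf Λ S).filter (fun c => Clean S c.1 v (θ * r)), f c := by
    have hnn : 0 ≤ ∑ c ∈ Conf Λ S, f c := Finset.sum_nonneg fun c _ => hf0 c
    have h1 : (∑ c ∈ (Conf Λ S).filter (fun c => ¬ Clean S c.1 v (θ * r)), f c) ≤
        1 / 2 * ∑ c ∈ Conf Λ S, f c := hP₂.trans (mul_le_mul_of_nonneg_right hCθ hnn)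
    linarith [hsplit, h1]
  have hQ : (∑ c ∈ (Conf Λ S).filter (fun c => Clean S c.1 v (θ * r)), f c) ≤
      c₀⁻¹ * r ^ κ * ∑ c ∈ (Conf Λ S).filter (fun c => Clean S c.1 v (θ * r)), g c := by
    rw [Finset.mul_sum]
    refine Finset.sum_le_sum fun c hc => ?_
    rw [Finset.mem_filter] at hc
    by_cases hamp : amp Λ a S c = 0
    · have : f c = 0 := by simp [hf, hamp]
      rw [this]
      exact mul_nonneg (mul_nonneg (inv_nonneg.2 hc₀.le) (Real.rpow_nonneg hr0.le _)) (hg0 c)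
    · have key := hE2 r hr₂ Λ hΛ a ha v hv hdeep hwin w₀ w₁ w₂ hstar c hc.1 hamp hc.2
      have hrk : r ^ (-κ) = (r ^ κ)⁻¹ := Real.rpow_neg hr0.le κ
      have hrκ : 0 < r ^ κ := Real.rpow_pos_of_pos hr0 κ
      rw [hrk] at key
      have key' : pmass c.1 (root c) v w₀ w₁ w₂ ≤
          c₀⁻¹ * r ^ κ * ‖mono c.1 (root c) v w₀ w₁ w₂‖ := by
        rw [← div_le_iff₀' (by positivity)]
        calc pmass c.1 (root c) v w₀ w₁ w₂ / (c₀⁻¹ * r ^ κ)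
            = c₀ * (r ^ κ)⁻¹ * pmass c.1 (root c) v w₀ w₁ w₂ := by field_simp
          _ ≤ _ := key
      calc f c = ‖amp Λ a S c‖ * pmass c.1 (root c) v w₀ w₁ w₂ := rfl
        _ ≤ ‖amp Λ a S c‖ * (c₀⁻¹ * r ^ κ * ‖mono c.1 (root c) v w₀ w₁ w₂‖) :=
            mul_le_mul_of_nonneg_left key' (norm_nonneg _)
        _ = c₀⁻¹ * r ^ κ * g c := by simp only [hg]; ring
  have hNc : (∑ c ∈ (Conf Λ S).filter (fun c => Clean S c.1 v (θ * r)), g c) ≤ N :=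
    sum_filter_le_sum_of_nonneg _ _ _ fun c _ => hg0 c
  have hTot : (∑ c ∈ Conf Λ S, f c) ≤ 2 * c₀⁻¹ * r ^ κ * N := by
    have h' : (∑ c ∈ (Conf Λ S).filter (fun c => Clean S c.1 v (θ * r)), f c) ≤
        c₀⁻¹ * r ^ κ * N := hQ.trans (mul_le_mul_of_nonneg_left hNc (by positivity))
    linarith [hPall, h']
  -- local sums as functions of the radius
  set P : ℝ → ℝ := fun t => ∑ c ∈ (Conf Λ S).filter (fun c => ¬ Clean S c.1 v t), f c with hP
  set U : ℝ → ℝ := fun t => ∑ c ∈ (Conf Λ S).filter (fun c => ¬ Clean S c.1 v t), g c with hU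
  -- (2) E1 combined with (1)
  have hPt : ∀ t : ℝ, 1 ≤ t → t ≤ r → P t ≤ C * t ^ ρ * (2 * c₀⁻¹) * r ^ (κ - ρ) * N := by
    intro t ht1 htr
    have e1 : P t ≤ C * (t / r) ^ ρ * ∑ c ∈ Conf Λ S, f c :=
      hE1 r hr₁ t ht1 htr Λ hΛ a ha v hv hdeep hwin w₀ w₁ w₂ hstar
    have ht0 : 0 ≤ t := zero_le_one.trans ht1
    calc P t ≤ C * (t / r) ^ ρ * ∑ c ∈ Conf Λ S, f c := e1
      _ ≤ C * (t / r) ^ ρ * (2 * c₀⁻¹ * r ^ κ * N) :=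
          mul_le_mul_of_nonneg_left hTot (mul_nonneg hC (Real.rpow_nonneg (by positivity) _))
      _ = C * t ^ ρ * (2 * c₀⁻¹) * r ^ (κ - ρ) * N := by
          rw [Real.div_rpow ht0 hr0.le, Real.rpow_sub hr0]
          field_simp
  -- (3) one tier: E3 on the configurations clean at `t` but not at `2t`
  have htier : ∀ t : ℝ, 1 ≤ t → 2 * t ≤ r → U (2 * t) ≤ U t + C₁ * t ^ (-κ) * P (2 * t) := by
    intro t ht1 ht2
    have ht0 : 0 ≤ t := zero_le_one.trans ht1
    simp only [hU, hP]
    rw [← Finset.sum_filter_add_sum_filter_not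
      ((Conf Λ S).filter (fun c => ¬ Clean S c.1 v (2 * t))) (fun c => Clean S c.1 v t) g]
    have hA' : (∑ c ∈ ((Conf Λ S).filter (fun c => ¬ Clean S c.1 v (2 * t))).filter
          (fun c => Clean S c.1 v t), g c) ≤
        C₁ * t ^ (-κ) * ∑ c ∈ (Conf Λ S).filter (fun c => ¬ Clean S c.1 v (2 * t)), f c := by
      calc (∑ c ∈ ((Conf Λ S).filter (fun c => ¬ Clean S c.1 v (2 * t))).filter
              (fun c => Clean S c.1 v t), g c)
          ≤ ∑ c ∈ ((Conf Λ S).filter (fun c => ¬ Clean S c.1 v (2 * t))).filter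
              (fun c => Clean S c.1 v t), C₁ * t ^ (-κ) * f c := by
            refine Finset.sum_le_sum fun c hc => ?_
            rw [Finset.mem_filter] at hc
            have hcC : c ∈ Conf Λ S := (Finset.mem_filter.1 hc.1).1
            have e3 :=
              hE3 r t ht1 (by linarith) Λ hΛ a ha v hv hdeep hwin w₀ w₁ w₂ hstar c hcC hc.2
            calc g c = ‖amp Λ a S c‖ * ‖mono c.1 (root c) v w₀ w₁ w₂‖ := rfl
              _ ≤ ‖amp Λ a S c‖ * (C₁ * t ^ (-κ) * pmass c.1 (root c) v w₀ w₁ w₂) :=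
                  mul_le_mul_of_nonneg_left e3 (norm_nonneg _)
              _ = C₁ * t ^ (-κ) * f c := by simp only [hf]; ring
        _ = C₁ * t ^ (-κ) * ∑ c ∈ ((Conf Λ S).filter (fun c => ¬ Clean S c.1 v (2 * t))).filter
              (fun c => Clean S c.1 v t), f c := by rw [Finset.mul_sum]
        _ ≤ C₁ * t ^ (-κ) * ∑ c ∈ (Conf Λ S).filter (fun c => ¬ Clean S c.1 v (2 * t)), f c :=
            mul_le_mul_of_nonneg_left (sum_filter_le_sum_of_nonneg _ _ _ fun c _ => hf0 c)
              (mul_nonneg hC₁ (Real.rpow_nonneg ht0 _))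
    have hB' : (∑ c ∈ ((Conf Λ S).filter (fun c => ¬ Clean S c.1 v (2 * t))).filter
          (fun c => ¬ Clean S c.1 v t), g c) ≤
        ∑ c ∈ (Conf Λ S).filter (fun c => ¬ Clean S c.1 v t), g c := by
      apply Finset.sum_le_sum_of_subset_of_nonneg
      · intro c hc
        simp only [Finset.mem_filter] at hc ⊢
        exact ⟨hc.1.1, hc.2⟩
      · intro c _ _
        exact hg0 c
    linarith
  -- (4) the dyadic scale of `η r`
  obtain ⟨J, hJ1, hJ2⟩ := exists_nat_pow_near hηr1 one_lt_two
  have h2J : (0 : ℝ) < 2 ^ J := by positivity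
  set s : ℝ := η * r / 2 ^ J with hs
  have hs1 : 1 ≤ s := by rw [hs, le_div_iff₀ h2J]; linarith
  have hs2 : s < 2 := by
    rw [hs, div_lt_iff₀ h2J]
    have : (2 : ℝ) ^ (J + 1) = 2 * 2 ^ J := by rw [pow_succ]; ring
    linarith [hJ2]
  have hs0 : 0 < s := lt_of_lt_of_le one_pos hs1
  have hsJ : s * 2 ^ J = η * r := by rw [hs]; field_simp
  -- (5) induction over the tiers
  have key : ∀ j : ℕ, j ≤ J →
      U (s * 2 ^ j) ≤ U s + A * (q / (q - 1)) * ((s * 2 ^ j) ^ δ * r ^ (κ - ρ)) * N := by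
    intro j
    induction j with
    | zero =>
      intro _
      simp only [pow_zero, mul_one]
      have : 0 ≤ A * (q / (q - 1)) * (s ^ δ * r ^ (κ - ρ)) * N := by positivity
      linarith
    | succ j ih =>
      intro hj
      have ih' := ih (Nat.le_of_succ_le hj)
      have hx1 : 1 ≤ s * 2 ^ j :=
        le_trans hs1 (le_mul_of_one_le_right hs0.le (one_le_pow₀ one_le_two))
      have hx0 : 0 < s * 2 ^ j := lt_of_lt_of_le one_pos hx1
      have ht2 : 2 * (s * 2 ^ j) ≤ r := by
        have hle : s * 2 ^ (j + 1) ≤ s * 2 ^ J :=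
          mul_le_mul_of_nonneg_left (pow_le_pow_right₀ one_le_two hj) hs0.le
        have : s * 2 ^ (j + 1) = 2 * (s * 2 ^ j) := by rw [pow_succ]; ring
        linarith [hsJ, hηrr]
      have e := htier (s * 2 ^ j) hx1 ht2
      have hP' := hPt (2 * (s * 2 ^ j)) (by linarith) ht2
      have hrew : s * 2 ^ (j + 1) = 2 * (s * 2 ^ j) := by rw [pow_succ]; ring
      rw [hrew]
      have h2x : 0 < 2 * (s * 2 ^ j) := by positivity
      -- the increment of tier `j`
      have hinc : C₁ * (s * 2 ^ j) ^ (-κ) * P (2 * (s * 2 ^ j)) ≤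
          A * ((2 * (s * 2 ^ j)) ^ δ * r ^ (κ - ρ)) * N := by
        calc C₁ * (s * 2 ^ j) ^ (-κ) * P (2 * (s * 2 ^ j))
            ≤ C₁ * (s * 2 ^ j) ^ (-κ) *
                (C * (2 * (s * 2 ^ j)) ^ ρ * (2 * c₀⁻¹) * r ^ (κ - ρ) * N) :=
              mul_le_mul_of_nonneg_left hP' (mul_nonneg hC₁ (Real.rpow_nonneg hx0.le _))
          _ = A * ((2 * (s * 2 ^ j)) ^ δ * r ^ (κ - ρ)) * N := by
              rw [hA, hδ, Real.rpow_sub h2x, Real.mul_rpow (x := 2) (by norm_num) hx0.le (z := κ),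
                Real.rpow_neg hx0.le]
              have hxκ : (s * 2 ^ j) ^ κ ≠ 0 := (Real.rpow_pos_of_pos hx0 κ).ne'
              have h2κ : (2 : ℝ) ^ κ ≠ 0 := (Real.rpow_pos_of_pos two_pos κ).ne'
              field_simp
      have hgeom : (2 * (s * 2 ^ j)) ^ δ = q * (s * 2 ^ j) ^ δ := by
        rw [hq, Real.mul_rpow (by norm_num) hx0.le]
      calc U (2 * (s * 2 ^ j))
          ≤ U (s * 2 ^ j) + C₁ * (s * 2 ^ j) ^ (-κ) * P (2 * (s * 2 ^ j)) := e
        _ ≤ U s + A * (q / (q - 1)) * ((s * 2 ^ j) ^ δ * r ^ (κ - ρ)) * N +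
              A * ((2 * (s * 2 ^ j)) ^ δ * r ^ (κ - ρ)) * N := by linarith
        _ = U s + A * (q / (q - 1)) * ((2 * (s * 2 ^ j)) ^ δ * r ^ (κ - ρ)) * N := by
            rw [hgeom]
            field_simp
            ring
  -- (6) conclusion
  have hfinal := key J le_rfl
  rw [hsJ] at hfinal
  have hpow' : (η * r) ^ δ * r ^ (κ - ρ) = η ^ δ := by
    rw [Real.mul_rpow hη0.le hr0.le, hδ, show κ - ρ = -(ρ - κ) by ring, Real.rpow_neg hr0.le]
    have : r ^ (ρ - κ) ≠ 0 := (Real.rpow_pos_of_pos hr0 _).ne'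
    field_simp
  have hUs : U s ≤ K₂ * r ^ (κ - ρ) * N := by
    calc U s ≤ P s := Finset.sum_le_sum fun c _ => hgf c
      _ ≤ P 2 := sum_filter_le_sum_filter_of_imp _ _ _ _
          (fun c _ hn hcl => hn (clean_anti S c.1 v s 2 hs2.le hcl)) (fun c _ => hf0 c)
      _ ≤ C * 2 ^ ρ * (2 * c₀⁻¹) * r ^ (κ - ρ) * N := hPt 2 (by norm_num) hr2
      _ = K₂ * r ^ (κ - ρ) * N := by rw [hK₂]; field_simp
  have hKr : K₂ * r ^ (κ - ρ) < ϑ / 2 := hR r hrR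
  show U (η * r) ≤ ϑ * N
  calc U (η * r) ≤ U s + A * (q / (q - 1)) * ((η * r) ^ δ * r ^ (κ - ρ)) * N := hfinal
    _ = U s + A * (q / (q - 1)) * η ^ δ * N := by rw [← hpow']
    _ ≤ K₂ * r ^ (κ - ρ) * N + ϑ / 2 * N :=
        add_le_add hUs (mul_le_mul_of_nonneg_right hmain hNnn)
    _ ≤ ϑ / 2 * N + ϑ / 2 * N := by gcongr
    _ = ϑ * N := by ring

/-! ### The registered statement from E1 + E2 + E3 -/

/-- **S5' ⇐ E1 + E2 + E3 (conditional reduction; the estimates are hypotheses, not asserted).** For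
`0 ≤ κ < ρ`, `CoherentReentryGap ρ`, `CleanMonopoleLowerBound κ` and `MonopoleDecoherence κ` imply the
windowed re-entry arm separation: the conclusion is, verbatim, the registered signature of
`stub_reentryArmSeparation` (both conjuncts; (i) by `reentryAspect_of_armEstimates`, (ii) by
`reentryFixedRadius_of_armEstimates`). Heuristically `κ = 25/48`, `ρ = 3/2`. -/
theorem reentryArmSeparation_of_armEstimates :
    ∀ ρ κ : ℝ, 0 ≤ κ → κ < ρ →
      CoherentReentryGap ρ → CleanMonopoleLowerBound κ → MonopoleDecoherence κ →
    (∀ ϑ : ℝ, 0 < ϑ → ∃ η : ℝ, 0 < η ∧ η ≤ 1 ∧ ∃ r₀ : ℝ, ∀ r : ℝ, r₀ ≤ r →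
      ∀ Λ : Finset HexVertex, hexDomainSimplyConnected Λ → ∀ a ∈ hexDomainBoundary Λ, ∀ v ∈ Λ,
        Deep Λ v (2 * r) → ¬ Deep Λ v (4 * r) → ∀ w₀ w₁ w₂ : HexVertex, IsStar v w₀ w₁ w₂ →
          (∑ c ∈ (Conf Λ (ball Λ v r)).filter (fun c => ¬ Clean (ball Λ v r) c.1 v (η * r)),
              ‖amp Λ a (ball Λ v r) c‖ * ‖mono c.1 (root c) v w₀ w₁ w₂‖) ≤
            ϑ * ∑ c ∈ Conf Λ (ball Λ v r),
              ‖amp Λ a (ball Λ v r) c‖ * ‖mono c.1 (root c) v w₀ w₁ w₂‖) ∧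
    (∀ d₀ : ℝ, 0 ≤ d₀ → ∀ ϑ : ℝ, 0 < ϑ → ∃ r₀ : ℝ, ∀ r : ℝ, r₀ ≤ r →
      ∀ Λ : Finset HexVertex, hexDomainSimplyConnected Λ → ∀ a ∈ hexDomainBoundary Λ, ∀ v ∈ Λ,
        Deep Λ v (2 * r) → ¬ Deep Λ v (4 * r) → ∀ w₀ w₁ w₂ : HexVertex, IsStar v w₀ w₁ w₂ →
          (∑ c ∈ (Conf Λ (ball Λ v r)).filter (fun c => ¬ Clean (ball Λ v r) c.1 v d₀),
              ‖amp Λ a (ball Λ v r) c‖ * pmass c.1 (root c) v w₀ w₁ w₂) ≤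
            ϑ * ∑ c ∈ Conf Λ (ball Λ v r),
              ‖amp Λ a (ball Λ v r) c‖ * ‖mono c.1 (root c) v w₀ w₁ w₂‖) :=
  fun ρ κ hκ hκρ h1 h2 h3 =>
    ⟨reentryAspect_of_armEstimates hκ hκρ h1 h2 h3,
      reentryFixedRadius_of_armEstimates ρ κ hκ hκρ h1 h2⟩

end Summit.CriticalPhenomena.SAWScalingLimit.Theorems.InteriorFlattening.OneMouth

end
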